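import Summits.CriticalPhenomena.PercolationContinuityZ3.Theorems.PercNearOneGluingNoHeavyQuantSGCLightCellsNoLow
import HarnessLib

/-!
# QUANT lane R8, T-DEC, leg (III): `SingleGateConvClosed` HOLDS FOR TWO FACTORS WITHOUT NONZERO LOW ATOMS (every charged atom `a` of
# `μᵢ` has `q·Tᵢ ≤ 2a`) — unconditionally, by the moment criterion; the DEC hypotheses of SGC are not even needed there

builds on p205010 (kernel theorem, internal audit signed; external expert review pending)

Support file (`--supports stmt-CriticalPhenomena-4575`), QUANT lane, seat prim-quant-arm-3 (gen 121), rung R8 of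
`run/shared/lean/prim/quant/LADDER.md`.  One theorem, standard axioms, no sorries, no definitions.  Companion of `…QuantSGCLightCellsNoLow`
(`gate_lconv_decAt_of_noLow`, `exists_of_lconv_pos`) and `…QuantSGCLightPairPairHolds` (cell PP, the instance "two admissible light pairs").

* **`LawDec.singleGateConvClosed_of_noLow_factors`** — in the binder of `LawDec.SingleGateConvClosed` (floor `0 < y < 1`, gate `0 < q ≤ 1`,
  probability laws `μ₁` on `{0..M₁}`, `μ₂` on `{0..M₂}`, gated versions top-affordable), if every charged atom `a` of `μ₁` satisfies
  `q·T₁ ≤ 2a` and every charged atom `b` of `μ₂` satisfies `q·T₂ ≤ 2b` (`Tᵢ` the means), then `gate_q(μ₁ ∗ μ₂)` is DEC at every layer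
  `j′ < M₁ + M₂` — WITHOUT using the DEC hypotheses on the factors: every charged atom of the product is `a + b ≥ q(T₁+T₂)/2`, the product is
  top-affordable in the sum, and lead g30's moment criterion applies (`gate_lconv_decAt_of_noLow`).  Instances: both factors admissible LIGHT
  pairs (an admissible light pair has `q·T ≤ 2·lo`, `lightPair_two_lo_ge` — this is cell PP, `sgcLightPairPair_holds`); sure points; any
  mixture of such laws of a common mean.  So the whole difficulty of `SingleGateConvClosed` sits in factors WITH a nonzero low atom
  (heavy pairs with a small `lo` — the CW side — and non-HD triples with `2s₁ < q·T₂` — the PT/TT residuals).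
HONEST STATUS: `SingleGateConvClosed`, CW, L2, L3, PT/TT residuals, `GateMove`, `TreeDEC`, `FarTreeRow` remain OPEN; nothing here is a
published result; RATE class log\* / honest sentence unchanged.

[this work]; moment criterion: prim-quant-lead g30; SGC: prim-quant-lead g28 (this lane).  The gluing rows served
[cite: KozmaNitzan2024, Conjecture 3 (p. 15)]; product measure [cite: Grimmett1999, §1.3 p. 10].
-/

noncomputable section

namespace Summit.CriticalPhenomena.PercolationContinuityZ3.Theorems

namespace Quant

open Finset

namespace LawDec

/-- **`SingleGateConvClosed` FOR FACTORS WITHOUT NONZERO LOWS.**  See the module docstring. [this work] -/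
theorem singleGateConvClosed_of_noLow_factors (y q : ℝ) (M₁ M₂ : ℕ) (μ₁ μ₂ : ℕ → ℝ)
    (hy0 : 0 < y) (hy1 : y < 1) (hq0 : 0 < q) (hq1 : q ≤ 1)
    (h10 : ∀ h, 0 ≤ μ₁ h) (_h1M : ∀ h, M₁ < h → μ₁ h = 0) (h11 : ∑ h ∈ Finset.range (M₁ + 1), μ₁ h = 1)
    (hta₁ : y * (M₁ : ℝ) ≤ q * ∑ h ∈ Finset.range (M₁ + 1), (h : ℝ) * μ₁ h)
    (h20 : ∀ h, 0 ≤ μ₂ h) (_h2M : ∀ h, M₂ < h → μ₂ h = 0) (h21 : ∑ h ∈ Finset.range (M₂ + 1), μ₂ h = 1)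
    (hta₂ : y * (M₂ : ℝ) ≤ q * ∑ h ∈ Finset.range (M₂ + 1), (h : ℝ) * μ₂ h)
    (hnl₁ : ∀ a, 0 < μ₁ a → q * ∑ h ∈ Finset.range (M₁ + 1), (h : ℝ) * μ₁ h ≤ 2 * (a : ℝ))
    (hnl₂ : ∀ b, 0 < μ₂ b → q * ∑ h ∈ Finset.range (M₂ + 1), (h : ℝ) * μ₂ h ≤ 2 * (b : ℝ)) :
    ∀ j', j' < M₁ + M₂ → DECAt y j' (M₁ + M₂) (gate (lconv M₁ M₂ μ₁ μ₂) q) := by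
  intro j' hj'
  set T₁ : ℝ := ∑ h ∈ Finset.range (M₁ + 1), (h : ℝ) * μ₁ h with hT₁
  set T₂ : ℝ := ∑ h ∈ Finset.range (M₂ + 1), (h : ℝ) * μ₂ h with hT₂
  have hta : y * ((M₁ : ℝ) + M₂) ≤ q * (T₁ + T₂) := by rw [mul_add, mul_add]; exact add_le_add hta₁ hta₂
  have hM : (1 : ℝ) ≤ (M₁ : ℝ) + M₂ := by exact_mod_cast (show 1 ≤ M₁ + M₂ by omega)
  have htpos : 0 < q * (T₁ + T₂) := lt_of_lt_of_le (by nlinarith) hta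
  refine gate_lconv_decAt_of_noLow y q T₁ T₂ M₁ M₂ j' μ₁ μ₂ hy0 hy1 hq0.le hq1 h10 h11 rfl h20 h21 rfl htpos hta ?_
  intro k hk1 hkj hlow
  rcases (lconv_nonneg M₁ M₂ μ₁ μ₂ h10 h20 k).eq_or_lt with hz | hpos
  · exact hz.symm
  · exfalso
    obtain ⟨a, b, hab, ha, hb⟩ := exists_of_lconv_pos M₁ M₂ μ₁ μ₂ h10 h20 k hpos
    have e1 := hnl₁ a ha
    have e2 := hnl₂ b hb
    have hk : ((a : ℝ) + b) = k := by exact_mod_cast hab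
    have : q * (T₁ + T₂) ≤ 2 * (k : ℝ) := by rw [← hk]; linarith
    linarith

end LawDec

end Quant

end Summit.CriticalPhenomena.PercolationContinuityZ3.Theorems
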